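import Mathlib.Analysis.Complex.Basic
import Mathlib.Combinatorics.Enumerative.Partition.Basic
import Literature.RepresentationTheory.FiniteGroups.IsotypicProjector
import Literature.NumberTheory.DiophantineGeometry.SymmetricGroupReps
import Literature.Barriers.ValiantsHypothesis.GCTMatrixPoweringProp17OnlyIf
import HarnessLib

/-!
# Aldous' `λ₁` of the interchange process in an irreducible representation of the symmetric group

Topic `Literature/RepresentationTheory/FiniteGroups` (definition item `defn-AldousLambdaOne`,
wanted by `stmt-HubbardSuperconductivity-6673`, route `HubbardSuperconductivity/HyperoctahedralMott`).
Sources: G. Alon, G. Kozma, *Ordering the representations of `Sₙ` using the interchange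
process*, Canad. Math. Bull. 56 (2013) (arXiv:1003.1710), §1 and eq. (1); P. Caputo,
T. M. Liggett, T. Richthammer, *Proof of Aldous' spectral gap conjecture*, J. Amer. Math. Soc. 23
(2010) 831–851 (arXiv:0906.1238), §1.

For a finite set of sites `V`, `n = |V|`, and symmetric non-negative rates `A = (a_{xy})`, the
interchange process is the continuous-time random walk on `𝔖_V` generated by the transpositions
`(x y)` at rates `a_{xy}`; its generator is (minus) the **interchange Laplacian**
`L_A = Σ_{x<y} a_{xy} (1 - (x y)) ∈ ℝ[𝔖_V]` acting on `ℂ[𝔖_V]` by LEFT multiplication (the left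
regular representation). `ℂ[𝔖_V] = ⊕_{λ ⊢ n} (dim λ)·S^λ`, and on the `λ`-isotypic component `L_A`
acts through the irreducible representation `ρ_λ` (Specht module `S^λ`); Aldous' number
`λ₁(A; λ)` (Alon–Kozma, eq. (1): "`λ₁(A; ρ)` the smallest eigenvalue of `Σ a_{xy}(1 - ρ((xy)))`")
is the smallest eigenvalue of `ρ_λ(L_A)`, equivalently the minimum of the Rayleigh quotient of
`L_A` on the `λ`-isotypic component of `ℂ[𝔖_V]` (`L_A` is self-adjoint and positive semidefinite
for the `ℓ²` inner product: `⟨f, (1 - (xy))f⟩ = ½ Σ_h |f(h) - f((xy)h)|²`, and it commutes with the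
isotypic projectors, which are central). Aldous' spectral gap conjecture = the CLR theorem:
`λ₁(A; [n-1,1]) ≤ λ₁(A; λ)` for every `λ ≠ [n]` (Alon–Kozma §1; CLR Thm. 1.1).

## Contents (real definitions)

* `permLeftRegular n : Representation ℂ 𝔖ₙ (𝔖ₙ → ℂ)`, `(λ(g)f)(h) = f(g⁻¹h)`, `𝔖ₙ = Equiv.Perm (Fin n)`
  (Mathlib's `Representation.leftRegular` transported to plain functions along `Finsupp.equivFunOnFinite`);
* `interchangeLaplacian n A : End_ℂ(𝔖ₙ → ℂ)`, `L_A = Σ_{x<y} a_{xy} (1 - λ((x y)))`;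
* `isotypicComponent n μ` — the range of the isotypic projector
  `P_μ = (dim μ/ n!) Σ_t χ^μ(t) λ(t⁻¹)` of the Specht character `χ^μ` (`IsotypicProjector.lean`,
  `SymmetricGroupReps.lean`) in the left regular representation;
* `rayleighQuotient`, `aldousLambdaOneFin n A μ = inf` of the Rayleigh quotients of `L_A` over the
  non-zero vectors of the `μ`-isotypic component (`= λ_min(ρ_μ(L_A))`; `sInf ∅ = 0` never occurs,
  every isotypic component of the regular representation being non-zero);
* `AldousLambdaOne A μ` (the requested notion, for any finite type `V` of sites,
  `μ : Nat.Partition (Fintype.card V)`): transport of the sites to `Fin n` by `Fintype.equivFin V`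
  (independent of the enumeration: relabelling `V` conjugates `𝔖_V ≅ 𝔖ₙ` by an inner
  automorphism, which preserves every isotypic type).
* Proved API: unfolding lemmas, `permLeftRegular_apply`, `interchangeLaplacian_apply_const`
  (`L_A` kills constants), `rayleighQuotient_nonneg` (positive semidefiniteness),
  `aldousLambdaOneFin_nonneg` / `AldousLambdaOne_nonneg` (`λ₁ ≥ 0`), `aldousLambdaOneFin_indiscrete`.

Also proved: `aldousLambdaOneFin_indiscrete` — requested API (i), `λ₁(A;[n]) = 0` (the constants lie in
the trivial isotypic component, `const_mem_isotypicComponent_indiscrete`, via `χ^{(n)} ≡ 1`,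
`Literature.Barriers.ValiantsHypothesis.spechtCharacter_indiscrete`). NOT here (follow-ups): the CLR
theorem `λ₁(A;[n-1,1]) ≤ λ₁(A;μ)` (`μ ≠ [n]`) as a named fact, the complete-graph formula
`λ₁(1; μ) = n(n-1)/2 - c(μ)` (Diaconis–Shahshahani), and the Aldous order.

## References

* [AlonKozma2013] G. Alon, G. Kozma, Ordering the representations of `Sₙ` using the interchange
  process, Canad. Math. Bull. 56 (2013), §1, eq. (1).
* [CaputoLiggettRichthammer2010] P. Caputo, T. M. Liggett, T. Richthammer, Proof of Aldous'
  spectral gap conjecture, J. Amer. Math. Soc. 23 (2010), §1, Thm. 1.1.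
-/

noncomputable section

open scoped BigOperators ComplexConjugate
open Module
open Literature.NumberTheory.DiophantineGeometry (spechtCharacter)

namespace Literature.RepresentationTheory.FiniteGroups

/-! ### The left regular representation of `𝔖ₙ` on functions and the interchange Laplacian -/

section Regular

variable (n : ℕ)

/-- **The left regular representation** of `𝔖ₙ = Equiv.Perm (Fin n)` on `ℂ[𝔖ₙ]`, realised on
functions `𝔖ₙ → ℂ`: `(λ(g) f)(h) = f(g⁻¹ h)` (so that the indicator of `h` is sent to the
indicator of `g h`). This is Mathlib's `Representation.leftRegular ℂ (Equiv.Perm (Fin n))`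
(`= ofMulAction` on `MonoidAlgebra`, finitely supported functions) transported along
`Finsupp.equivFunOnFinite` to plain functions, which carry the `ℓ²` sums used below; it is given a
distinct name (`permLeftRegular`) so as not to shadow `Representation.leftRegular` under
`open Representation`. [cite: AlonKozma2013, §1] -/
def permLeftRegular : Representation ℂ (Equiv.Perm (Fin n)) (Equiv.Perm (Fin n) → ℂ) where
  toFun g := LinearMap.funLeft ℂ ℂ fun h ↦ g⁻¹ * h
  map_one' := by
    ext f h
    simp
  map_mul' g g' := by
    ext f h
    simp [LinearMap.funLeft, mul_assoc]

/-- `(λ(g) f)(h) = f(g⁻¹h)`. [cite: AlonKozma2013, §1] -/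
@[simp]
theorem permLeftRegular_apply (g : Equiv.Perm (Fin n)) (f : Equiv.Perm (Fin n) → ℂ) (h : Equiv.Perm (Fin n)) :
    permLeftRegular n g f h = f (g⁻¹ * h) :=
  rfl

/-- **The interchange Laplacian** `L_A = Σ_{x<y} a_{xy} (1 - λ((x y)))` of the rates
`A : Fin n → Fin n → ℝ` in the left regular representation (minus the generator of the interchange
process; only the entries `a_{xy}`, `x < y`, are used). [cite: AlonKozma2013, §1 eq. (1)]
[cite: CaputoLiggettRichthammer2010, §1] -/
def interchangeLaplacian (A : Fin n → Fin n → ℝ) : Module.End ℂ (Equiv.Perm (Fin n) → ℂ) :=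
  ∑ x : Fin n, ∑ y : Fin n with x < y, ((A x y : ℝ) : ℂ) • (1 - permLeftRegular n (Equiv.swap x y))

/-- `(L_A f)(h) = Σ_{x<y} a_{xy} (f(h) - f((x y) h))` (a transposition is its own inverse).
[cite: AlonKozma2013, §1 eq. (1)] -/
theorem interchangeLaplacian_apply (A : Fin n → Fin n → ℝ) (f : Equiv.Perm (Fin n) → ℂ)
    (h : Equiv.Perm (Fin n)) :
    interchangeLaplacian n A f h =
      ∑ x : Fin n, ∑ y : Fin n with x < y, ((A x y : ℝ) : ℂ) * (f h - f (Equiv.swap x y * h)) := by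
  simp [interchangeLaplacian, LinearMap.sum_apply, Finset.sum_apply, Equiv.swap_inv]

/-- `L_A` kills the constants (`(x y)` fixes every constant function). [cite: AlonKozma2013, §1] -/
theorem interchangeLaplacian_apply_const (A : Fin n → Fin n → ℝ) (c : ℂ) :
    interchangeLaplacian n A (fun _ ↦ c) = 0 := by
  ext h
  rw [interchangeLaplacian_apply]
  simp

/-! ### Isotypic components of the regular representation and Aldous' `λ₁` -/

/-- **The `μ`-isotypic component of `ℂ[𝔖ₙ]`** (`μ ⊢ n`): the range of the isotypic projector
`P_μ = (χ^μ(1)/n!) Σ_t χ^μ(t) λ(t⁻¹)` of the Specht character `χ^μ` in the left regular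
representation — the sum of all copies of the Specht module `S^μ` in `ℂ[𝔖ₙ]`.
[cite: AlonKozma2013, §1] -/
def isotypicComponent (μ : Nat.Partition n) : Submodule ℂ (Equiv.Perm (Fin n) → ℂ) :=
  LinearMap.range (isotypicProj (permLeftRegular n) (spechtCharacter ℂ μ))

/-- **The Rayleigh quotient** `⟨f, L_A f⟩ / ⟨f, f⟩` of the interchange Laplacian at `f ∈ ℂ[𝔖ₙ]` for
the `ℓ²` inner product (real part; `L_A` is self-adjoint so `⟨f, L_A f⟩` is real).
[cite: AlonKozma2013, §1 eq. (1)] -/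
def rayleighQuotient (A : Fin n → Fin n → ℝ) (f : Equiv.Perm (Fin n) → ℂ) : ℝ :=
  (∑ h, conj (f h) * interchangeLaplacian n A f h).re / ∑ h, ‖f h‖ ^ 2

/-- **Aldous' `λ₁(A; μ)` on the sites `Fin n`:** the smallest eigenvalue of `ρ_μ(L_A)`, entered as
the infimum of the Rayleigh quotients of `L_A` over the non-zero vectors of the `μ`-isotypic
component of `ℂ[𝔖ₙ]` (a minimum, the component being finite-dimensional and non-zero; `L_A`
preserves it, being a combination of the `λ(t)`, which commute with the central projector `P_μ`).
[cite: AlonKozma2013, §1 eq. (1)] [cite: CaputoLiggettRichthammer2010, §1] -/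
def aldousLambdaOneFin (A : Fin n → Fin n → ℝ) (μ : Nat.Partition n) : ℝ :=
  sInf (rayleighQuotient n A '' {f | f ∈ isotypicComponent n μ ∧ f ≠ 0})

end Regular

/-- **Aldous' `λ₁(A; μ)`** ("`λ₁(A; ρ)` the smallest eigenvalue of `Σ_{x<y} a_{xy}(1 - ρ((xy)))`",
Alon–Kozma eq. (1)) for a finite type of sites `V`, rates `A : V → V → ℝ` (intended symmetric and
non-negative) and `μ ⊢ |V|` indexing the irreducible representation `ρ_μ = S^μ` of `𝔖_V`: the sites
are enumerated by `Fintype.equivFin V` and `aldousLambdaOneFin` is applied (the value does not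
depend on the enumeration). Named `AldousLambdaOne` as requested by the definition item.
[cite: AlonKozma2013, §1 eq. (1)] [cite: CaputoLiggettRichthammer2010, §1] -/
def AldousLambdaOne {V : Type*} [Fintype V] (A : V → V → ℝ) (μ : Nat.Partition (Fintype.card V)) : ℝ :=
  aldousLambdaOneFin (Fintype.card V)
    (fun i j ↦ A ((Fintype.equivFin V).symm i) ((Fintype.equivFin V).symm j)) μ

/-! ### Positivity -/

section Positivity

variable (n : ℕ)

/-- `Σ_h conj(f h) (f h - f(t h))` has real part `½ Σ_h |f h - f(t h)|² ≥ 0` for an involution `t`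
(here a transposition): the quadratic form of `1 - λ(t)` is positive semidefinite.
[cite: CaputoLiggettRichthammer2010, §1] -/
theorem re_sum_conj_mul_sub_nonneg (t : Equiv.Perm (Fin n)) (ht : t * t = 1) (f : Equiv.Perm (Fin n) → ℂ) :
    0 ≤ (∑ h, conj (f h) * (f h - f (t * h))).re := by
  -- pair `h` with `t h`: twice the sum is `Σ_h ‖f h - f (t h)‖²`
  set S : ℂ := ∑ h, conj (f h) * (f h - f (t * h)) with hS
  set S' : ℂ := ∑ h, conj (f (t * h)) * (f (t * h) - f h) with hS'
  have htt : ∀ h, t * (t * h) = h := fun h ↦ by rw [← mul_assoc, ht, one_mul]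
  have hbij : S' = S := by
    rw [hS, hS']
    refine (Fintype.sum_equiv (Equiv.mulLeft t) _ _ fun h ↦ ?_).symm
    simp only [Equiv.coe_mulLeft, htt]
  have hsum : S + S' = ∑ h, conj (f h - f (t * h)) * (f h - f (t * h)) := by
    rw [hS, hS', ← Finset.sum_add_distrib]
    refine Finset.sum_congr rfl fun h _ ↦ ?_
    rw [map_sub]
    ring
  have h2 : 2 * S.re = ∑ h, ‖f h - f (t * h)‖ ^ 2 := by
    have hre : 2 * S.re = (S + S').re := by rw [hbij, Complex.add_re, two_mul]
    rw [hre, hsum, Complex.re_sum]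
    refine Finset.sum_congr rfl fun h _ ↦ ?_
    rw [Complex.conj_mul', ← Complex.ofReal_pow, Complex.ofReal_re]
  have hsq : 0 ≤ ∑ h, ‖f h - f (t * h)‖ ^ 2 := Finset.sum_nonneg fun h _ ↦ by positivity
  linarith

/-- **`L_A` is positive semidefinite for non-negative rates:** every Rayleigh quotient is `≥ 0`.
[cite: CaputoLiggettRichthammer2010, §1] -/
theorem rayleighQuotient_nonneg {A : Fin n → Fin n → ℝ} (hA : ∀ x y, 0 ≤ A x y)
    (f : Equiv.Perm (Fin n) → ℂ) : 0 ≤ rayleighQuotient n A f := by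
  unfold rayleighQuotient
  refine div_nonneg ?_ (Finset.sum_nonneg fun h _ ↦ by positivity)
  have hexpC : ∑ h, conj (f h) * interchangeLaplacian n A f h =
      ∑ x : Fin n, ∑ y : Fin n with x < y,
        ((A x y : ℝ) : ℂ) * ∑ h, conj (f h) * (f h - f (Equiv.swap x y * h)) := by
    simp_rw [interchangeLaplacian_apply, Finset.mul_sum]
    rw [Finset.sum_comm]
    refine Finset.sum_congr rfl fun x _ ↦ ?_
    rw [Finset.sum_comm]
    refine Finset.sum_congr rfl fun y _ ↦ Finset.sum_congr rfl fun h _ ↦ ?_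
    ring
  have hexp : (∑ h, conj (f h) * interchangeLaplacian n A f h).re =
      ∑ x : Fin n, ∑ y : Fin n with x < y,
        A x y * (∑ h, conj (f h) * (f h - f (Equiv.swap x y * h))).re := by
    rw [hexpC, Complex.re_sum]
    refine Finset.sum_congr rfl fun x _ ↦ ?_
    rw [Complex.re_sum]
    refine Finset.sum_congr rfl fun y _ ↦ ?_
    rw [Complex.re_ofReal_mul]
  rw [hexp]
  refine Finset.sum_nonneg fun x _ ↦ Finset.sum_nonneg fun y _ ↦ mul_nonneg (hA x y) ?_
  exact re_sum_conj_mul_sub_nonneg n (Equiv.swap x y) (Equiv.swap_mul_self x y) f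

/-- Hence `λ₁(A; μ) ≥ 0` (an infimum of non-negative reals; also for the junk value `sInf ∅ = 0`).
[cite: CaputoLiggettRichthammer2010, §1] -/
theorem aldousLambdaOneFin_nonneg {A : Fin n → Fin n → ℝ} (hA : ∀ x y, 0 ≤ A x y) (μ : Nat.Partition n) :
    0 ≤ aldousLambdaOneFin n A μ := by
  unfold aldousLambdaOneFin
  refine Real.sInf_nonneg ?_
  rintro _ ⟨f, -, rfl⟩
  exact rayleighQuotient_nonneg n hA f

/-! ### The trivial representation: `λ₁(A; [n]) = 0` -/

/-- The constants lie in the isotypic component of the trivial representation `[n]`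
(`χ^{(n)} ≡ 1`, so `P_{(n)}` is the averaging operator, which fixes the constants).
[cite: AlonKozma2013, §1] -/
theorem const_mem_isotypicComponent_indiscrete (c : ℂ) :
    (fun _ ↦ c) ∈ isotypicComponent n (Nat.Partition.indiscrete n) := by
  refine ⟨fun _ ↦ c, ?_⟩
  ext h
  rw [isotypicProj_apply]
  simp only [Literature.Barriers.ValiantsHypothesis.spechtCharacter_indiscrete, mul_one,
    Finset.sum_apply, Pi.smul_apply, permLeftRegular_apply, smul_eq_mul, Finset.sum_const,
    Finset.card_univ, nsmul_eq_mul]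
  rw [← mul_assoc, mul_div_cancel₀ _ (by exact_mod_cast Fintype.card_ne_zero), one_mul]

/-- **`λ₁(A; [n]) = 0`:** in the trivial representation the interchange Laplacian vanishes
(requested API (i)). The hypothesis `0 ≤ A` is used only to bound the Rayleigh quotients below (the
`sInf` needs `BddBelow`); mathematically it is superfluous, the `[n]`-isotypic component being the
constants, on which every quotient is `0`. [cite: AlonKozma2013, §1] -/
theorem aldousLambdaOneFin_indiscrete {A : Fin n → Fin n → ℝ} (hA : ∀ x y, 0 ≤ A x y) :
    aldousLambdaOneFin n A (Nat.Partition.indiscrete n) = 0 := by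
  refine le_antisymm ?_ (aldousLambdaOneFin_nonneg n hA _)
  unfold aldousLambdaOneFin
  have h0 : rayleighQuotient n A (fun _ ↦ (1 : ℂ)) = 0 := by
    simp [rayleighQuotient, interchangeLaplacian_apply_const]
  have hmem : (0 : ℝ) ∈ rayleighQuotient n A '' {f | f ∈ isotypicComponent n (Nat.Partition.indiscrete n) ∧ f ≠ 0} :=
    ⟨fun _ ↦ 1, ⟨const_mem_isotypicComponent_indiscrete n 1, fun h ↦ by simpa using congrFun h 1⟩, h0⟩
  refine csInf_le ⟨0, ?_⟩ hmem
  rintro _ ⟨f, -, rfl⟩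
  exact rayleighQuotient_nonneg n hA f

end Positivity

/-- `λ₁(A; μ) ≥ 0` for non-negative rates on any finite type of sites. [cite: CaputoLiggettRichthammer2010, §1] -/
theorem AldousLambdaOne_nonneg {V : Type*} [Fintype V] {A : V → V → ℝ} (hA : ∀ x y, 0 ≤ A x y)
    (μ : Nat.Partition (Fintype.card V)) : 0 ≤ AldousLambdaOne A μ :=
  aldousLambdaOneFin_nonneg _ (fun _ _ ↦ hA _ _) μ

end Literature.RepresentationTheory.FiniteGroups

end
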